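import Summits.NavierStokesRegularity.NavierStokesRegularity.Theorems.TypeICertificateLadderNoBlowupToClay
import Literature.StrongHypotheses.NavierStokesRegularity
import Literature.Analysis.FluidPDE.NSCriticalClosureEssSup
import HarnessLib

/-!
# Bridge `LerayHopfLThreeBound ⇒ Clay (A)` — discharge of the printed bridge of the Strong-Hypothesis Library

The registry `Literature/StrongHypotheses/NavierStokesRegularity.lean` (row 2) records the open
strong hypothesis `LerayHopfLThreeBound` — every Leray–Hopf weak solution of the unforced system on
`ℝ³ × [0,T)` from a Clay datum lies in `L^∞(0,T; L³(ℝ³))` — and the summit-side file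
`Summits/NavierStokesRegularity/StrongHypotheses.lean` records its bridge to Fefferman's (A) as a
PRINTED named fact `LerayHopfLThreeBoundImpliesNavierStokesRegularity : Prop :=
LerayHopfLThreeBound → NavierStokesRegularity` (Escauriaza–Seregin–Šverák 2003, Thm. 1.4, with
Leray 1934 and the local smooth theory), "to be discharged … as
`theorem LerayHopfLThreeBoundImpliesNavierStokesRegularity_holds`" in this file.

This file is that discharge (the bridge `Prop` unfolds to `LerayHopfLThreeBound →
NavierStokesRegularity`, which is the type proved here verbatim; the registry module itself is an
operator file that `Theorems/` files do not import). The proof follows the plan printed in the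
docstring of the named fact: go through the landed frame theorem "no finite-time blow-up of
classical Leray–Hopf solutions from rapidly decaying data ⇒ (A)"
(`Theses.TypeICertificateLadder.NoBlowupToClay`, proved as
`Theorems.typeICertificateLadder_noBlowupToClay_proof`, stmt-NavierStokesRegularity-0055; it is the
`→` half of `noBlowup_iff_navierStokesRegularity`) and prove the no-blow-up statement from
`LerayHopfLThreeBound` by the tree's `L³` continuation criterion in its printed
`L_{3,∞}(Q_T)` form, `Literature.Analysis.FluidPDE.hasSmoothExtensionPast_of_memLqLp_top_three`
(`NSCriticalClosureEssSup.lean`; ESS 2003 Thm. 1.4 / Seregin 2012 Thm. 1.1 / Robinson–Rodrigo–Sadowski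
2016 Thm. 16.4, itself proved over the DISCHARGED criterion
`hasSmoothExtensionPast_of_eLpNorm_three_bounded_holds`): given a classical solution `(u, p)` on
`[0,T)`, Leray–Hopf on `[0,T]` from its rapidly decaying datum `u 0`, the hypothesis applied to the
Clay datum `u 0` (smooth and divergence free because the solution is classical at `t = 0`) puts
`u` in `L^∞(0,T; L³)`, and the criterion extends `u` smoothly past `T`.

Cell `ns-claims` (D-0090) context: this is the TRUE closing step "`L^∞_t L³_x` (⊇ `L^∞_t Ḣ^{1/2}_x`)
⇒ regular ⇒ (A)" on which the harmonic-analysis family of claimed regularity proofs relies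
(salvage seat p4); it is classical (ESS 2003), independent of any claim under adjudication.

WHAT THIS IS NOT: not a claim about NS regularity or blow-up; not a claim about any author beyond the typed locator.

## References

* L. Escauriaza, G. Seregin, V. Šverák, *`L_{3,∞}`-solutions of Navier–Stokes equations and
  backward uniqueness*, Russ. Math. Surveys 58 (2003), 211–250, Thms. 1.3–1.4.
  [`EscauriazaSereginSverak2003`]
* G. Seregin, Comm. Math. Phys. 312 (2012), 833–845, Thm. 1.1. [`Seregin2012CMP`]
* J. Leray, Acta Math. 63 (1934), Ch. V §31. [`Leray1934`]
-/

noncomputable section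

namespace Summit.NavierStokesRegularity.StrongHypotheses

open Set MeasureTheory
open scoped ENNReal ContDiff
open Literature.Analysis.FluidPDE
open Literature.StrongHypotheses.NavierStokesRegularity
open Summit.NavierStokesRegularity.NavierStokesRegularity.Theorems
  (typeICertificateLadder_noBlowupToClay_proof)

/-- **`LerayHopfLThreeBound ⇒ no blow-up`.** If every Leray–Hopf weak solution of the unforced
system from a Clay datum lies in `L^∞(0,T; L³(ℝ³))`, then every classical solution on `[0,T)`
which is Leray–Hopf on `[0,T]` from its rapidly decaying datum extends smoothly past `T`
(Escauriaza–Seregin–Šverák 2003, Thm. 1.4, in the tree's `L_{3,∞}` continuation form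
`hasSmoothExtensionPast_of_memLqLp_top_three`). [cite: EscauriazaSereginSverak2003, Thm. 1.4] -/
theorem noBlowup_of_lerayHopfLThreeBound (H : LerayHopfLThreeBound) :
    ∀ (ν T : ℝ), 0 < ν → 0 < T →
      ∀ (u : ℝ → EuclideanSpace ℝ (Fin 3) → EuclideanSpace ℝ (Fin 3))
        (p : ℝ → EuclideanSpace ℝ (Fin 3) → ℝ),
        IsClassicalNSSolutionOn (Ico 0 T) ν 0 u p → IsLerayHopfOn T ν 0 (u 0) u →
          HasRapidSpatialDecay (u 0) → HasSmoothExtensionPast ν 0 u T := by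
  intro ν T hν hT u p hcl hLH hdec
  have h0 : (0 : ℝ) ∈ Ico 0 T := ⟨le_rfl, hT⟩
  have h₃ : MemLqLp ∞ 3 u (Ioo 0 T) :=
    H ν T hν hT (u 0) u (hcl.contDiff_velocity h0) (fun x => hcl.divFree 0 h0 x) hdec hLH
  exact hasSmoothExtensionPast_of_memLqLp_top_three hν hT hcl hLH hdec h₃

/-- **Discharge of the printed bridge** `LerayHopfLThreeBoundImpliesNavierStokesRegularity`
(Strong-Hypothesis Library, summit `NavierStokesRegularity`, row 2; the bridge `Prop`
`Summit.NavierStokesRegularity.StrongHypotheses.LerayHopfLThreeBoundImpliesNavierStokesRegularity`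
unfolds to exactly this type): the `L^∞_t L³_x` bound for all Leray–Hopf solutions from Clay
data implies Fefferman's Clay statement (A) (`NavierStokesRegularity`), via
`noBlowup_of_lerayHopfLThreeBound` and the landed frame theorem
`typeICertificateLadder_noBlowupToClay_proof` (no blow-up ⇒ (A)).
[cite: EscauriazaSereginSverak2003, Thm. 1.4] -/
theorem LerayHopfLThreeBoundImpliesNavierStokesRegularity_holds :
    LerayHopfLThreeBound → _root_.NavierStokesRegularity :=
  fun H => typeICertificateLadder_noBlowupToClay_proof (noBlowup_of_lerayHopfLThreeBound H)

end Summit.NavierStokesRegularity.StrongHypotheses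

end
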